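import Literature.AlgebraicGeometry.Frobenioids.EquivalenceStepPrimeFrobenius
import Literature.AlgebraicGeometry.Frobenioids.FSMIMorphisms
import HarnessLib

/-!
# Frobenioids I, §3: Theorem 3.4 (ii) for Frobenioids of isotropic type over bases of FSM-type

Mochizuki, *The geometry of Frobenioids I: the general theory*, Kyushu J. Math. **62** (2008),
Thm. 3.4 (ii), kurims p. 62 [cite: MochizukiFrdI2008, Thm. 3.4 (ii) p.62]. The printed proof of (ii) runs
through Prop. 1.14 (iii), whose "⟸" half fails inside the theorem's scope (standard Frobenioid; seat
abc-iut-L1-t11). This PROOF-ONLY file (seat abc-iut-L1-t13, the cell's repair programme for D-ζ-a; OURS, not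
attributed to the paper) proves, by a different route:

* `FrdI.isLinear_map_of_isPreStep`: an equivalence `Ψ` between Frobenioids of ISOTROPIC type (bases merely
  totally epimorphic) maps every pre-step to a LINEAR morphism — the Frobenius-type part `γ'` of
  `Ψ(φ) = α' ∘ β' ∘ γ'` (Def. 1.3 (iv)(a)) is invertible, since otherwise a prime-Frobenius factor of it
  (Prop. 1.10 (v)) would come from an irreducible PRE-STEP of `C₁`, which by Prop. 1.14 (i) is a step — excluded
  by `not_isPrimeFrobenius_map_of_isStep` — or has non-invertible base;
* `FrdI.isPreStep_map_of_isOfFSMType`: if moreover `D₂` is of FSM-type (e.g. the connected objects of a Galois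
  category, Rem. 3.1.3), `Ψ` maps pre-steps to PRE-STEPS — the pull-back part `α'` is the image of a co-angular
  pre-step, hence an FSM-morphism (Prop. 1.11 (vii)), so its base is FSM (Prop. 1.11 (vi)), so invertible;
* `FrdI.isGroupLikeObj_map_of_isOfFSMType`: with `D₁` of FSM-type as well, `Ψ` preserves group-like objects
  (an object of an isotropic Frobenioid is group-like iff every pre-step out of it is invertible, Def. 1.3 (iii)(d)).
Together: the three clauses of Thm. 3.4 (ii) for Frobenioids of isotropic type over bases of FSM-type
(`FrdI.thm34ii_isotropic_of_isOfFSMType`). No statement of the paper is restated or strengthened.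
-/

-- Equivalence unit/counit components and `(F ⋙ G).obj` need default transparency.
set_option backward.isDefEq.respectTransparency false

namespace Literature.AlgebraicGeometry.Frobenioids

open CategoryTheory Opposite

universe w v v' u u'

namespace FrdI

section Two

variable {D₁ : Type u} [Category.{v} D₁] {Φ₁ : D₁ᵒᵖ ⥤ CommMonCat.{w}} {C₁ : Type u'}
  [Category.{v'} C₁] {D₂ : Type u} [Category.{v} D₂] {Φ₂ : D₂ᵒᵖ ⥤ CommMonCat.{w}} {C₂ : Type u'}
  [Category.{v'} C₂] {F₁ : C₁ ⥤ ElemFrobenioid Φ₁} {F₂ : C₂ ⥤ ElemFrobenioid Φ₂}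

/-- A prime-Frobenius morphism conjugated by isomorphisms is prime-Frobenius.
[cite: MochizukiFrdI2008, Def. 1.2 (iii) p.22] -/
theorem isPrimeFrobenius_iso_comp_iso (hF₂ : PreFrobenioid.IsFrobenioid F₂) {X A B Y : C₂} (i : X ⟶ A)
    [IsIso i] {π : A ⟶ B} (hπ : PreFrobenioid.IsPrimeFrobenius F₂ π) (j : B ⟶ Y) [IsIso j] :
    PreFrobenioid.IsPrimeFrobenius F₂ (i ≫ π ≫ j) := by
  refine ⟨PreFrobenioid.IsFrobeniusType.comp F₂ hF₂
    (PreFrobenioid.isFrobeniusType_of_isIso F₂ hF₂.isPreFrobenioid i)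
    (PreFrobenioid.IsFrobeniusType.comp F₂ hF₂ hπ.1
      (PreFrobenioid.isFrobeniusType_of_isIso F₂ hF₂.isPreFrobenioid j)), ?_⟩
  rw [PreFrobenioid.degFr_comp, PreFrobenioid.degFr_comp,
    show PreFrobenioid.degFr F₂ i = 1 from PreFrobenioid.isLinear_of_isIso F₂ i,
    show PreFrobenioid.degFr F₂ j = 1 from PreFrobenioid.isLinear_of_isIso F₂ j, one_mul, mul_one]
  exact hπ.2

/-- The key step: in isotropic Frobenioids, `Ψ⁻¹` of a prime-Frobenius morphism is never a pre-step
(Prop. 1.14 (i) + `not_isPrimeFrobenius_map_of_isStep`). [cite: MochizukiFrdI2008, Thm. 3.4 (ii) p.62] -/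
theorem not_isPreStep_inverse_map_of_isPrimeFrobenius (hF₁ : PreFrobenioid.IsFrobenioid F₁)
    (hF₂ : PreFrobenioid.IsFrobenioid F₂) (hi₁ : ∀ A : C₁, PreFrobenioid.IsIsotropic F₁ A)
    (hi₂ : ∀ A : C₂, PreFrobenioid.IsIsotropic F₂ A) (Ψ : C₁ ≌ C₂) {A B : C₂} {π : A ⟶ B}
    (hπ : PreFrobenioid.IsPrimeFrobenius F₂ π) : ¬ PreFrobenioid.IsPreStep F₁ (Ψ.inverse.map π) := by
  intro hρ
  have hirr : IsIrreducibleHom (Ψ.inverse.map π) :=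
    (hπ.isIrreducibleHom hF₂ (hi₂ _)).map_equivalence Ψ.symm
  rcases PreFrobenioid.trichotomy_of_isIrreducibleHom F₁ hF₁ hi₁ hirr with h | ⟨hstep, -⟩ | ⟨-, hbase⟩
  · have h1 : (PreFrobenioid.degFr F₁ (Ψ.inverse.map π) : ℕ) = 1 := by
      rw [show PreFrobenioid.degFr F₁ (Ψ.inverse.map π) = 1 from hρ.1, PNat.one_coe]
    exact (Nat.Prime.one_lt h.2).ne' h1
  · apply not_isPrimeFrobenius_map_of_isStep hF₁ hF₂ hi₁ hi₂ Ψ hstep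
    rw [Ψ.fun_inv_map]
    exact isPrimeFrobenius_iso_comp_iso hF₂ _ hπ _
  · exact hbase.1 hρ.2

/-- **`Ψ` maps pre-steps to linear morphisms** (isotropic type; bases only totally epimorphic).
[cite: MochizukiFrdI2008, Thm. 3.4 (ii) p.62] -/
theorem isLinear_map_of_isPreStep (hF₁ : PreFrobenioid.IsFrobenioid F₁) (hF₂ : PreFrobenioid.IsFrobenioid F₂)
    (hi₁ : ∀ A : C₁, PreFrobenioid.IsIsotropic F₁ A) (hi₂ : ∀ A : C₂, PreFrobenioid.IsIsotropic F₂ A)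
    (Ψ : C₁ ≌ C₂) {A B : C₁} {φ : A ⟶ B} (hφ : PreFrobenioid.IsPreStep F₁ φ) :
    PreFrobenioid.IsLinear F₂ (Ψ.functor.map φ) := by
  have hD₁ := hF₁.isPreFrobenioid.isTotallyEpimorphic_base
  obtain ⟨X, Y, γ, β, α, hfac, hγ, hβ, hα⟩ := hF₂.iv_a_exists (Ψ.functor.map φ)
  -- the Frobenius-type part has degree one
  have hγ1 : PreFrobenioid.degFr F₂ γ = 1 := by
    by_contra hne
    set d : ℕ := (PreFrobenioid.degFr F₂ γ : ℕ) with hd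
    have hd1 : d ≠ 1 := fun h => hne (PNat.eq (by rw [PNat.one_coe]; exact h))
    have hp : (Nat.minFac d).Prime := Nat.minFac_prime hd1
    obtain ⟨k, hk⟩ := Nat.minFac_dvd d
    have hkpos : 0 < k := Nat.pos_of_ne_zero fun h0 => by
      rw [h0, mul_zero] at hk
      exact PNat.ne_zero _ hk
    obtain ⟨X', μ, ν, hμν, hμ, hμd, -, -⟩ := PreFrobenioid.exists_split_of_isFrobeniusType hF₂ hγ
      ⟨Nat.minFac d, Nat.minFac_pos d⟩ ⟨k, hkpos⟩ (PNat.eq (by rw [PNat.mul_coe]; exact hk))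
    have hμp : PreFrobenioid.IsPrimeFrobenius F₂ μ := ⟨hμ, by rw [hμd]; exact hp⟩
    -- `Ψ⁻¹ μ` is a factor of the pre-step `η⁻¹ ≫ φ ≫ η`
    have hpre : PreFrobenioid.IsPreStep F₁ (Ψ.inverse.map (Ψ.functor.map φ)) := by
      rw [Ψ.inv_fun_map]
      exact PreFrobenioid.IsPreStep.comp F₁ (PreFrobenioid.isPreStep_of_isIso F₁ _)
        (PreFrobenioid.IsPreStep.comp F₁ hφ (PreFrobenioid.isPreStep_of_isIso F₁ _))
    rw [← hfac, ← hμν, Category.assoc, Functor.map_comp] at hpre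
    exact not_isPreStep_inverse_map_of_isPrimeFrobenius hF₁ hF₂ hi₁ hi₂ Ψ hμp
      (PreFrobenioid.isPreStep_factors F₁ hD₁ hpre).2
  change PreFrobenioid.degFr F₂ (Ψ.functor.map φ) = 1
  rw [← hfac, PreFrobenioid.degFr_comp, PreFrobenioid.degFr_comp, hγ1,
    show PreFrobenioid.degFr F₂ β = 1 from hβ.1, show PreFrobenioid.degFr F₂ α = 1 from (hF₂.iv_b α hα).2,
    mul_one, mul_one]

/-- **`Ψ` maps pre-steps to pre-steps when `D₂` is of FSM-type** (isotropic type).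
[cite: MochizukiFrdI2008, Thm. 3.4 (ii) p.62] -/
theorem isPreStep_map_of_isOfFSMType (hF₁ : PreFrobenioid.IsFrobenioid F₁)
    (hF₂ : PreFrobenioid.IsFrobenioid F₂) (hi₁ : ∀ A : C₁, PreFrobenioid.IsIsotropic F₁ A)
    (hi₂ : ∀ A : C₂, PreFrobenioid.IsIsotropic F₂ A) (hD₂ : IsOfFSMType D₂) (Ψ : C₁ ≌ C₂)
    {A B : C₁} {φ : A ⟶ B} (hφ : PreFrobenioid.IsPreStep F₁ φ) :
    PreFrobenioid.IsPreStep F₂ (Ψ.functor.map φ) := by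
  have hD₁ := hF₁.isPreFrobenioid.isTotallyEpimorphic_base
  obtain ⟨X, Y, γ, β, α, hfac, hγ, hβ, hα⟩ := hF₂.iv_a_exists (Ψ.functor.map φ)
  -- `γ` is invertible (degree one by the previous theorem)
  have hlin := isLinear_map_of_isPreStep hF₁ hF₂ hi₁ hi₂ Ψ hφ
  have hγ1 : PreFrobenioid.degFr F₂ γ = 1 := by
    have := (PreFrobenioid.isLinear_factors F₂ (show PreFrobenioid.IsLinear F₂ (γ ≫ β ≫ α) by
      rw [hfac]; exact hlin)).2
    exact this
  haveI : IsIso γ := PreFrobenioid.isIso_of_isFrobeniusType_of_degFr_eq_one hF₂ hγ hγ1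
  -- `α` is invertible: it is the image of a co-angular pre-step, hence FSM, hence has FSM base
  have hpre : PreFrobenioid.IsPreStep F₁ (Ψ.inverse.map (Ψ.functor.map φ)) := by
    rw [Ψ.inv_fun_map]
    exact PreFrobenioid.IsPreStep.comp F₁ (PreFrobenioid.isPreStep_of_isIso F₁ _)
      (PreFrobenioid.IsPreStep.comp F₁ hφ (PreFrobenioid.isPreStep_of_isIso F₁ _))
  rw [← hfac, ← Category.assoc, Functor.map_comp] at hpre
  have hρ : PreFrobenioid.IsPreStep F₁ (Ψ.inverse.map α) := (PreFrobenioid.isPreStep_factors F₁ hD₁ hpre).1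
  have hρFSM : IsFSM (Ψ.inverse.map α) := PreFrobenioid.IsCoAngularPreStep.isFSM hF₁
    ⟨PreFrobenioid.isCoAngular_of_isIsotropic_codomains F₁ _ (fun Z _ => hi₁ Z), hρ⟩
  have hαFSM : IsFSM α := by
    have h := hρFSM.map_equivalence Ψ
    rw [Ψ.fun_inv_map] at h
    have e : α = Ψ.counitInv.app Y ≫ (Ψ.counit.app Y ≫ α ≫ Ψ.counitInv.app (Ψ.functor.obj B)) ≫
        Ψ.counit.app (Ψ.functor.obj B) := by
      simp
    rw [e]
    exact IsFSM.comp (IsFSM.of_isIso (Ψ.counitInv.app Y))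
      (IsFSM.comp h (IsFSM.of_isIso (Ψ.counit.app (Ψ.functor.obj B))))
  have hbα : IsIso (PreFrobenioid.Base F₂ α) :=
    hD₂.isIso_of_isFSM _ ((PreFrobenioid.isFSM_iff_of_isPullbackMorphism hF₂ hα).1 hαFSM)
  haveI : IsIso α := (PreFrobenioid.isPullbackMorphism_and_isBaseIso_iff_isIso F₂ α).1 ⟨hα, hbα⟩
  rw [← hfac]
  exact PreFrobenioid.IsPreStep.comp F₂ (PreFrobenioid.isPreStep_of_isIso F₂ γ)
    (PreFrobenioid.IsPreStep.comp F₂ hβ (PreFrobenioid.isPreStep_of_isIso F₂ α))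

/-- In a Frobenioid of isotropic type an object is group-like iff every pre-step out of it is
invertible (Def. 1.3 (iii)(d): every element of `Φ(A)` is the zero divisor of a co-angular pre-step).
[cite: MochizukiFrdI2008, Def. 1.2 (iv) p.23] -/
theorem isGroupLikeObj_iff_preSteps_isIso (hF₁ : PreFrobenioid.IsFrobenioid F₁)
    (hi₁ : ∀ A : C₁, PreFrobenioid.IsIsotropic F₁ A) (A : C₁) :
    PreFrobenioid.IsGroupLikeObj F₁ A ↔
      ∀ ⦃B : C₁⦄ (φ : A ⟶ B), PreFrobenioid.IsPreStep F₁ φ → IsIso φ := by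
  constructor
  · intro h B φ hφ
    exact hi₁ A φ (h (PreFrobenioid.Div F₁ φ)) hφ
  · intro h x
    obtain ⟨B, φ, hφ, hx⟩ := hF₁.iii_d_under_surj A x
    haveI := h φ hφ.2
    rw [← hx]
    exact PreFrobenioid.isIsometry_of_isIso F₁ hF₁.isPreFrobenioid φ

/-- **`Ψ` preserves group-like objects when `D₁` is of FSM-type** (isotropic type; apply
`isPreStep_map_of_isOfFSMType` to `Ψ⁻¹`). [cite: MochizukiFrdI2008, Thm. 3.4 (ii) p.62] -/
theorem isGroupLikeObj_map_of_isOfFSMType (hF₁ : PreFrobenioid.IsFrobenioid F₁)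
    (hF₂ : PreFrobenioid.IsFrobenioid F₂) (hi₁ : ∀ A : C₁, PreFrobenioid.IsIsotropic F₁ A)
    (hi₂ : ∀ A : C₂, PreFrobenioid.IsIsotropic F₂ A) (hD₁ : IsOfFSMType D₁) (Ψ : C₁ ≌ C₂) {A : C₁}
    (hA : PreFrobenioid.IsGroupLikeObj F₁ A) : PreFrobenioid.IsGroupLikeObj F₂ (Ψ.functor.obj A) := by
  rw [isGroupLikeObj_iff_preSteps_isIso hF₂ hi₂]
  intro B' φ' hφ'
  have hρ : PreFrobenioid.IsPreStep F₁ (Ψ.inverse.map φ') :=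
    isPreStep_map_of_isOfFSMType hF₂ hF₁ hi₂ hi₁ hD₁ Ψ.symm hφ'
  have h1 : PreFrobenioid.IsPreStep F₁ (Ψ.unit.app A ≫ Ψ.inverse.map φ') :=
    PreFrobenioid.IsPreStep.comp F₁ (PreFrobenioid.isPreStep_of_isIso F₁ _) hρ
  haveI : IsIso (Ψ.unit.app A ≫ Ψ.inverse.map φ') :=
    (isGroupLikeObj_iff_preSteps_isIso hF₁ hi₁ A).1 hA _ h1
  haveI : IsIso (Ψ.inverse.map φ') := IsIso.of_isIso_comp_left (Ψ.unit.app A) (Ψ.inverse.map φ')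
  exact isIso_of_fully_faithful Ψ.inverse φ'

/-- **Thm. 3.4 (ii) for Frobenioids of isotropic type over bases of FSM-type** (the cell's repaired
variant): `Ψ` preserves pre-steps, co-angular pre-steps and group-like objects.
[cite: MochizukiFrdI2008, Thm. 3.4 (ii) p.62] -/
theorem thm34ii_isotropic_of_isOfFSMType (hF₁ : PreFrobenioid.IsFrobenioid F₁)
    (hF₂ : PreFrobenioid.IsFrobenioid F₂) (hi₁ : ∀ A : C₁, PreFrobenioid.IsIsotropic F₁ A)
    (hi₂ : ∀ A : C₂, PreFrobenioid.IsIsotropic F₂ A) (hD₁ : IsOfFSMType D₁) (hD₂ : IsOfFSMType D₂)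
    (Ψ : C₁ ≌ C₂) :
    (∀ ⦃A B : C₁⦄ (φ : A ⟶ B), PreFrobenioid.IsPreStep F₁ φ → PreFrobenioid.IsPreStep F₂ (Ψ.functor.map φ)) ∧
      (∀ ⦃A B : C₁⦄ (φ : A ⟶ B), PreFrobenioid.IsCoAngularPreStep F₁ φ →
        PreFrobenioid.IsCoAngularPreStep F₂ (Ψ.functor.map φ)) ∧
      (∀ ⦃A : C₁⦄, PreFrobenioid.IsGroupLikeObj F₁ A → PreFrobenioid.IsGroupLikeObj F₂ (Ψ.functor.obj A)) :=
  ⟨fun _ _ _ hφ => isPreStep_map_of_isOfFSMType hF₁ hF₂ hi₁ hi₂ hD₂ Ψ hφ,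
    fun _ _ _ hφ => ⟨PreFrobenioid.isCoAngular_of_isIsotropic_codomains F₂ _ (fun Z _ => hi₂ Z),
      isPreStep_map_of_isOfFSMType hF₁ hF₂ hi₁ hi₂ hD₂ Ψ hφ.2⟩,
    fun _ hA => isGroupLikeObj_map_of_isOfFSMType hF₁ hF₂ hi₁ hi₂ hD₁ Ψ hA⟩

end Two

end FrdI

end Literature.AlgebraicGeometry.Frobenioids
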